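import Mathlib
import HarnessLib
import Summits.HubbardSuperconductivity.HubbardSuperconductivity.Theorems.KLProgrammeKLRegimeTwoVolumeLipDiffDefs

/-!
# Route `KLProgramme` — crux K3 ENGINE (stmt-HubbardSuperconductivity-20437), stub (e) proof-input «(e)-D-ROWS»: THE DEEP-PIN SIZES VANISH IN DEGREE `0`
# (seat hubbard-kl-k3c4-p1 g24; `--supports` 20437; the «degree-0 sizes 0» side condition of E1's door → kit dictionary for the two-volume arrays)

E1's door → kit dictionary (`…EngineTowerDoorToKit{,Lip,FO}`, consumed by `…TwoVolumeLipDoorKit` / `…LipBornDiffKit{,Units}` / `…LipBornDiffHstep`) asks every profile to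
have degree-`0` size `0` (`bE 0 = 0`, …).  For the two-volume difference arrays this is literal: in degree `m = 0` the index type `Fin 0 × {deep pins}` of the
supremum defining `klLipInputDiffSup` / `klLipBornDiffSup` (`…TwoVolumeLipDiffDefs`) is empty, and `⨆` over an empty type is `0` in `ℝ`.

* `klLipInputDiffSup_deg_zero`, `klLipBornDiffSup_deg_zero`; `klTowerMeasWt_deg_zero` (E1's weighted measured size, g24 append).

Pure bookkeeping; nothing asserts the (D) rows, stub (e), VL, K3 or superconductivity.
-/

noncomputable section

namespace Summit.HubbardSuperconductivity.HubbardSuperconductivity.Theorems.TwoVolumeLip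

set_option linter.dupNamespace false -- summit = problem name (single-conjunct summit), D-0017

open Finset Literature.MathematicalPhysics.QuantumLattice GrassmannAlgebra Literature.Probability.LatticeModels

variable {L b M : ℕ} [NeZero L] [NeZero (b * L)]

/-- **The measured-difference size vanishes in degree `0`.** -/
theorem klLipInputDiffSup_deg_zero (β U μ : ℝ) (K : TrigPolyC4v) (d k R : ℕ) : klLipInputDiffSup L b M β U μ K d k 0 R = 0 := by
  unfold klLipInputDiffSup
  haveI : IsEmpty (Fin 0 × {w : SpaceTimeIdx (b * L) M × SectorLeg (sectorCount (d * k - 1)) // w ∈ klDeepPins L R}) := by infer_instance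
  exact Real.iSup_of_isEmpty _

/-- **The born-difference size vanishes in degree `0`.** -/
theorem klLipBornDiffSup_deg_zero (β U μ : ℝ) (K : TrigPolyC4v) (d k R : ℕ) : klLipBornDiffSup L b M β U μ K d k 0 R = 0 := by
  unfold klLipBornDiffSup
  haveI : IsEmpty (Fin 0 × {w : SpaceTimeIdx (b * L) M × SectorLeg (sectorCount (d * k)) // w ∈ klDeepPins L R}) := by infer_instance
  exact Real.iSup_of_isEmpty _

/-- **E1's weighted measured size vanishes in degree `0`** (empty index type; the `At`-version is `EngineV8.klTowerMeasWtAt_zero`) — the `bV 0 = 0`, `bD 0 = 0`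
side conditions of `…TwoVolumeLipBornDiffKitUnits` with the profiles of `…TwoVolumeLipProfilesOfTower`. (g24 append) -/
theorem klTowerMeasWt_deg_zero {V M : ℕ} [NeZero V] (β U μ : ℝ) (K : TrigPolyC4v) (d k : ℕ) :
    Summit.HubbardSuperconductivity.HubbardSuperconductivity.Theorems.EngineV8.klTowerMeasWt V M β U μ K d k 0 = 0 := by
  unfold Summit.HubbardSuperconductivity.HubbardSuperconductivity.Theorems.EngineV8.klTowerMeasWt
  haveI : IsEmpty (Fin 0 × (SpaceTimeIdx V M × SectorLeg (sectorCount (d * k - 1)))) := by infer_instance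
  exact Real.iSup_of_isEmpty _

end Summit.HubbardSuperconductivity.HubbardSuperconductivity.Theorems.TwoVolumeLip

end
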